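import Literature.Analysis.FluidPDE.OnsagerCCFSEnergyProofs
import Literature.Analysis.FluidPDE.OnsagerCCFSFluxEstimateProofs
import HarnessLib

/-!
# Coarse-graining (cumulant) estimates on `T^d` for the Drivas–Eyink dissipation bound

Analysis/FluidPDE support file (serves the discharge of the barrier fact
`Literature.Barriers.AnomalousDissipation.DrivasEyink2019_lemma1_measurable`,
`Literature/Barriers/AnomalousDissipation/OnsagerSingularityLeray`; Drivas–Eyink 2019, §2, proof
of Lemma 1, estimates (CETflux2), (viscEst), (Otherest1)–(Otherest2)). For the standard torus
mollifier `k_ε = Torus.kernel ε` (`0 < ε ≤ 1/4`) and the componentwise mollification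
`Torus.vecConv v k_ε` of a velocity field (`FluidPDE/OnsagerCCFSFlux`; it is *definitionally*
`Torus.vecMollify ε v` of `FunctionSpaces/TorusMollifiedFields`,
`Torus.vecConv_kernel_eq_vecMollify` of `OnsagerCCFSFluxEstimateProofs`), all statements proved:

* **contraction**: `Torus.vecConv_kernel_apply_eq_integral` (`v ⋆ k_ε` as a kernel average of
  translates), `Torus.eLpNorm_vecConv_kernel_le_self` (`‖v ⋆ k_ε‖_{Lᵖ} ≤ ‖v‖_{Lᵖ}`, Minkowski–Jensen
  with the unit-mass kernel) and `Torus.kineticEnergy_vecConv_kernel_le` (`E(v ⋆ k_ε) ≤ E(v)`,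
  Drivas–Eyink's "`|ū_ℓ|² ≤ (|u|²)_ℓ` by convexity");
* **cumulants** (Drivas–Eyink 2019, (Otherest1)–(Otherest2); Constantin–E–Titi 1994, (9)–(11) with
  the exponents `(2, 2, 1)` in place of `(3, 3, 3/2)`): `Torus.lintegral_enorm_commutator_le`
  (`∫ |(fg) ⋆ k_ε - (f ⋆ k_ε)(g ⋆ k_ε)| ≤ 2 A_f A_g` for the `L²` translation moduli `A_f, A_g` at
  scale `ε`), the integrated scalar, vector and kinetic-energy forms
  `Torus.abs_integral_mul_sub_integral_convolution_mul_le`,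
  `Torus.abs_integral_inner_sub_integral_inner_vecConv_le`,
  `Torus.abs_kineticEnergy_sub_kineticEnergy_vecConv_le`, and their Besov specialisations
  (`A = [·]_{B^σ_{2,∞}} ε^σ`), e.g. `|E(v) - E(v ⋆ k_ε)| ≤ d ε^{2σ} [v]²_{B^σ_{2,∞}}`;
* **resolved dissipation** (Drivas–Eyink 2019, (viscEst); Constantin–E–Titi 1994, (7)):
  `Torus.gradNormSq_vecConv_kernel_le` (`‖∇(v ⋆ k_ε)‖₂² ≤ d² (C₁/ε)² A²`) and the Besov form
  `Torus.gradNormSq_vecConv_kernel_le_of_eBesovSupSeminorm`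
  (`‖∇(v ⋆ k_ε)‖₂² ≤ d² C₁² ε^{2σ-2} [v]²_{B^σ_{2,∞}}`);
* **flux**: through the accepted bridge `Torus.cetFlux_kernel_eq_integral_flux_vecMollify`
  (`OnsagerCCFSFluxEstimateProofs`) the Constantin–E–Titi estimate
  `Torus.abs_integral_flux_vecMollify_le_of_memBesovSup` (`TorusCommutatorEstimate`) becomes
  `Torus.abs_cetFlux_kernel_le_of_memBesovSup`
  (`|Π_{k_ε}[v]| ≤ 2 d² C₁ [v]³_{B^σ_{3,∞}} ε^{3σ-1}`, Drivas–Eyink 2019, (CETflux2)).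

## Mathlib search

Mathlib (this pin) has group convolution with `MeasureTheory.integral_convolution` (mass of a
convolution), Hölder through `eLpNorm_smul_le_mul_eLpNorm` and the `ENNReal.HolderTriple`
class (`HolderConjugate 2 2`), `MeasureTheory.eval_integral_piLp`; no mollifier cumulant or
commutator estimates (searched `commutator`, `cumulant`, `convolution_mul`). The tree supplies the
torus mollifier (`TorusMollifier`), Minkowski–Jensen (`Literature.Analysis.FunctionSpaces.eLpNorm_integral_smul_le_mul`) and the
CET identity (`Torus.convolution_mul_sub_mul_convolution`).

## References

* T. D. Drivas, G. L. Eyink, *An Onsager singularity theorem for Leray solutions of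
  incompressible Navier–Stokes*, Nonlinearity 32 (2019) 4465–4482 = arXiv:1710.05205, §2, proof
  of Lemma 1. [DrivasEyink2019]
* P. Constantin, W. E, E. S. Titi, *Onsager's conjecture on the energy conservation for solutions
  of Euler's equation*, Comm. Math. Phys. 165 (1994), 207–209, (6)–(11). [ConstantinETiti1994]
-/

noncomputable section

open MeasureTheory TopologicalSpace Set Function Filter Topology Metric ContinuousLinearMap
open scoped ENNReal NNReal Convolution InnerProductSpace RealInnerProductSpace

namespace Literature.Analysis.FluidPDE

namespace Torus

variable {d : Type*} [Fintype d] {ε : ℝ}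

/-! ## Mollified fields as kernel averages; the `Lᵖ` contraction -/

section Contraction

/-- A real mollification read with the kernel variable first:
`(θ ⋆ k_ε)(x) = ∫ k_ε(y) θ(x - y) dy`. [folklore] -/
theorem convolution_kernel_apply_eq_integral (θ : UnitAddTorus d → ℝ) (ε : ℝ) (x : UnitAddTorus d) :
    (θ ⋆ FunctionSpaces.Torus.kernel ε) x = ∫ y, FunctionSpaces.Torus.kernel ε y * θ (x - y) := by
  rw [FunctionSpaces.Torus.convolution_comm_real, convolution_lsmul]
  rfl

/-- **The mollified field as a kernel average of translates**: for `v ∈ L¹(T^d; ℝ^d)` and a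
continuous kernel, `(v ⋆ k_ε)(x) = ∫ k_ε(y) v(x - y) dy` as a Bochner integral in `ℝ^d`
(componentwise `Torus.convolution_kernel_apply_eq_integral` and Mathlib's
`MeasureTheory.eval_integral_piLp`). [folklore] -/
theorem vecConv_kernel_apply_eq_integral {v : UnitAddTorus d → EuclideanSpace ℝ d}
    (hv : Integrable v volume) (hε : 0 < ε) (hε' : ε ≤ 1 / 4) (x : UnitAddTorus d) :
    vecConv v (FunctionSpaces.Torus.kernel ε) x = ∫ y, FunctionSpaces.Torus.kernel ε y • v (x - y) := by
  have hk := FunctionSpaces.Torus.continuous_kernel (d := d) hε hε'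
  have hint : ∀ i, Integrable (fun y => (FunctionSpaces.Torus.kernel ε y • v (x - y)) i) volume := fun i => by
    have h := FunctionSpaces.Torus.integrable_kernel_smul_comp_sub (hv.eval_piLp i) hk x
    refine h.congr (Eventually.of_forall fun y => ?_)
    simp [smul_eq_mul]
  ext i
  rw [vecConv_apply, convolution_kernel_apply_eq_integral, eval_integral_piLp hint i]
  refine integral_congr_ae (Eventually.of_forall fun y => ?_)
  simp [smul_eq_mul]

/-- **Mollification contracts every `Lᵖ` norm** (`1 ≤ p < ∞`): `‖v ⋆ k_ε‖_{Lᵖ} ≤ ‖v‖_{Lᵖ}` for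
`v ∈ L¹(T^d; ℝ^d)` (Minkowski–Jensen `Literature.Analysis.FunctionSpaces.eLpNorm_integral_smul_le_mul` with the unit-mass kernel,
the translates `v(· - y)` all having the norm of `v`; Young's inequality with `‖k_ε‖₁ = 1`). [folklore] -/
theorem eLpNorm_vecConv_kernel_le_self {v : UnitAddTorus d → EuclideanSpace ℝ d}
    (hv : Integrable v volume) (hε : 0 < ε) (hε' : ε ≤ 1 / 4) {p : ℝ≥0∞} (hp : 1 ≤ p)
    (hp' : p ≠ ⊤) : eLpNorm (vecConv v (FunctionSpaces.Torus.kernel ε)) p volume ≤ eLpNorm v p volume := by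
  have hfun : vecConv v (FunctionSpaces.Torus.kernel ε) = fun x => ∫ y, FunctionSpaces.Torus.kernel ε y • v (x - y) :=
    funext fun x => vecConv_kernel_apply_eq_integral hv hε hε' x
  rw [hfun]
  have hΦ : AEStronglyMeasurable (uncurry fun x y : UnitAddTorus d => v (x - y))
      ((volume : Measure (UnitAddTorus d)).prod volume) :=
    hv.aestronglyMeasurable.comp_quasiMeasurePreserving
      (quasiMeasurePreserving_sub_of_right_invariant volume volume)
  refine (FunctionSpaces.eLpNorm_integral_smul_le_mul (FunctionSpaces.Torus.continuous_kernel hε hε').aestronglyMeasurable hΦ hp hp'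
    (A := eLpNorm v p volume) (Eventually.of_forall fun y _ => le_of_eq ?_)).trans ?_
  · exact eLpNorm_comp_measurePreserving hv.aestronglyMeasurable (measurePreserving_sub_right volume y)
  · rw [FunctionSpaces.Torus.lintegral_enorm_kernel hε hε', one_mul]

/-- Mollified `L¹` fields are continuous, hence in every `Lᵖ`. [folklore] -/
theorem memLp_vecConv_kernel {v : UnitAddTorus d → EuclideanSpace ℝ d} (hv : Integrable v volume)
    (hε : 0 < ε) (hε' : ε ≤ 1 / 4) (p : ℝ≥0∞) : MemLp (vecConv v (FunctionSpaces.Torus.kernel ε)) p volume :=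
  memLp_of_continuous (continuous_vecConv hv (FunctionSpaces.Torus.continuous_kernel hε hε')) p

/-- **Coarse-graining decreases the kinetic energy**: `E(v ⋆ k_ε) ≤ E(v)` for `v ∈ L²(T^d; ℝ^d)`
(Drivas–Eyink 2019, §2, proof of Lemma 1: "`|ū_ℓ|² ≤ (|u|²)_ℓ` by convexity and thus the
contribution from `τ_ℓ(u(·,T); u(·,T)) ≥ 0` is non-positive"; here through the `L²` contraction
`Torus.eLpNorm_vecConv_kernel_le_self`). [cite: DrivasEyink2019, §2, proof of Lemma 1] -/
theorem kineticEnergy_vecConv_kernel_le {v : UnitAddTorus d → EuclideanSpace ℝ d}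
    (hv : MemLp v 2 volume) (hε : 0 < ε) (hε' : ε ≤ 1 / 4) :
    FunctionSpaces.Torus.kineticEnergy (vecConv v (FunctionSpaces.Torus.kernel ε)) ≤ FunctionSpaces.Torus.kineticEnergy v := by
  have hv1 : Integrable v volume := hv.integrable one_le_two
  rw [kineticEnergy_eq_of_memLp (memLp_vecConv_kernel hv1 hε hε' 2), kineticEnergy_eq_of_memLp hv]
  have h := eLpNorm_vecConv_kernel_le_self hv1 hε hε' one_le_two ENNReal.ofNat_ne_top
  have h' : (eLpNorm (vecConv v (FunctionSpaces.Torus.kernel ε)) 2 volume).toReal ≤ (eLpNorm v 2 volume).toReal :=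
    ENNReal.toReal_mono hv.eLpNorm_ne_top h
  gcongr

end Contraction

/-! ## Cumulant (commutator) estimates with `L²` translation moduli -/

section Cumulant

/-- Hölder `L² · L² ⊂ L¹` for real functions. [folklore] -/
theorem eLpNorm_mul_one_le {α : Type*} [MeasurableSpace α] {μ : Measure α} {f g : α → ℝ}
    (hf : AEStronglyMeasurable f μ) (hg : AEStronglyMeasurable g μ) :
    eLpNorm (fun x => f x * g x) 1 μ ≤ eLpNorm f 2 μ * eLpNorm g 2 μ := by
  have h := @eLpNorm_smul_le_mul_eLpNorm _ _ _ _ μ _ _ _ _ 2 2 1 g hg f hf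
    ENNReal.HolderConjugate.instTwoTwo
  exact h

/-- Hölder `∫ |f g| ≤ ‖f‖_{L²} ‖g‖_{L²}` for real functions. [folklore] -/
theorem lintegral_enorm_mul_le_two_two {α : Type*} [MeasurableSpace α] {μ : Measure α}
    {f g : α → ℝ} (hf : AEStronglyMeasurable f μ) (hg : AEStronglyMeasurable g μ) :
    ∫⁻ x, ‖f x * g x‖ₑ ∂μ ≤ eLpNorm f 2 μ * eLpNorm g 2 μ := by
  have h := eLpNorm_mul_one_le hf hg
  rw [eLpNorm_one_eq_lintegral_enorm] at h
  exact h

/-- **The remainder is small in `L¹`** (Constantin–E–Titi 1994, (9)–(11) with exponents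
`(2, 2, 1)`): if the `L²` translation moduli of `f`, `g` at scale `ε` are at most `Af`, `Ag`, then
`‖r_ε(f,g)‖_{L¹} ≤ Af · Ag` for `r_ε(f,g)(x) = ∫ k_ε(y) (f(x-y) - f(x)) (g(x-y) - g(x)) dy`
(Minkowski–Jensen with the unit-mass kernel and Hölder `L² · L² ⊂ L¹`). [cite: ConstantinETiti1994, (9)–(11)] -/
theorem eLpNorm_commutatorRemainder_one_le {f g : UnitAddTorus d → ℝ}
    (hf : AEStronglyMeasurable f volume) (hg : AEStronglyMeasurable g volume) (hε : 0 < ε)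
    (hε' : ε ≤ 1 / 4) {Af Ag : ℝ≥0∞}
    (hAf : ∀ y : UnitAddTorus d, ‖y‖ ≤ ε → eLpNorm (fun x => f (x - y) - f x) 2 volume ≤ Af)
    (hAg : ∀ y : UnitAddTorus d, ‖y‖ ≤ ε → eLpNorm (fun x => g (x - y) - g x) 2 volume ≤ Ag) :
    eLpNorm (fun x => ∫ y, FunctionSpaces.Torus.kernel ε y * ((f (x - y) - f x) * (g (x - y) - g x))) 1 volume ≤
      Af * Ag := by
  have h := FunctionSpaces.eLpNorm_integral_smul_le_mul (F := ℝ) (FunctionSpaces.Torus.continuous_kernel hε hε').aestronglyMeasurable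
    (FunctionSpaces.Torus.aestronglyMeasurable_diff_mul_diff hf hg) le_rfl ENNReal.one_ne_top
    (A := Af * Ag) (Eventually.of_forall fun y hy => ?_)
  · rw [FunctionSpaces.Torus.lintegral_enorm_kernel hε hε', one_mul] at h
    exact h
  · have hy' : ‖y‖ ≤ ε := (mem_ball_zero_iff.1 (FunctionSpaces.Torus.support_kernel_subset hε hy)).le
    have hfm : AEStronglyMeasurable (fun x => f (x - y) - f x) volume :=
      (hf.comp_quasiMeasurePreserving
        (measurePreserving_sub_right volume y).quasiMeasurePreserving).sub hf
    have hgm : AEStronglyMeasurable (fun x => g (x - y) - g x) volume :=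
      (hg.comp_quasiMeasurePreserving
        (measurePreserving_sub_right volume y).quasiMeasurePreserving).sub hg
    exact (eLpNorm_mul_one_le hfm hgm).trans (mul_le_mul' (hAf y hy') (hAg y hy'))

/-- **The cumulant bound with `L²` moduli** (Drivas–Eyink 2019, §2, "estimates for
coarse-graining cumulants (see, e.g. [CET94, DE17])"; Constantin–E–Titi 1994, (11) with
exponents `(2, 2, 1)`): for `f, g ∈ L²(T^d)` with `L²` translation moduli `Af`, `Ag` at scale
`ε`, `∫ |((fg) ⋆ k_ε) - (f ⋆ k_ε)(g ⋆ k_ε)| ≤ 2 Af Ag` (the CET identity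
`Torus.convolution_mul_sub_mul_convolution`, the remainder bound, and CET (6) for the product of
the two mollification errors). [cite: DrivasEyink2019, §2, proof of Lemma 1, (Otherest1)–(Otherest2)] -/
theorem lintegral_enorm_commutator_le {f g : UnitAddTorus d → ℝ} (hf : MemLp f 2 volume)
    (hg : MemLp g 2 volume) (hε : 0 < ε) (hε' : ε ≤ 1 / 4) {Af Ag : ℝ≥0∞}
    (hAf : ∀ y : UnitAddTorus d, ‖y‖ ≤ ε → eLpNorm (fun x => f (x - y) - f x) 2 volume ≤ Af)
    (hAg : ∀ y : UnitAddTorus d, ‖y‖ ≤ ε → eLpNorm (fun x => g (x - y) - g x) 2 volume ≤ Ag) :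
    ∫⁻ x, ‖((fun y => f y * g y) ⋆ FunctionSpaces.Torus.kernel ε) x - (f ⋆ FunctionSpaces.Torus.kernel ε) x * (g ⋆ FunctionSpaces.Torus.kernel ε) x‖ₑ ≤
      2 * Af * Ag := by
  have hfi : Integrable f volume := hf.integrable one_le_two
  have hgi : Integrable g volume := hg.integrable one_le_two
  have hfg : Integrable (fun x => f x * g x) volume := hf.integrable_mul hg
  have hk := FunctionSpaces.Torus.continuous_kernel (d := d) hε hε'
  set r : UnitAddTorus d → ℝ := fun x => ∫ y, FunctionSpaces.Torus.kernel ε y * ((f (x - y) - f x) * (g (x - y) - g x))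
    with hr
  set ef : UnitAddTorus d → ℝ := fun x => f x - (f ⋆ FunctionSpaces.Torus.kernel ε) x with hef
  set eg : UnitAddTorus d → ℝ := fun x => g x - (g ⋆ FunctionSpaces.Torus.kernel ε) x with heg
  have hcf : Continuous (f ⋆ FunctionSpaces.Torus.kernel ε) := FunctionSpaces.Torus.continuous_convolution hfi hk
  have hcg : Continuous (g ⋆ FunctionSpaces.Torus.kernel ε) := FunctionSpaces.Torus.continuous_convolution hgi hk
  have hefm : AEStronglyMeasurable ef volume := hf.1.sub hcf.aestronglyMeasurable
  have hegm : AEStronglyMeasurable eg volume := hg.1.sub hcg.aestronglyMeasurable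
  have hrm : AEStronglyMeasurable r volume := by
    have := FunctionSpaces.Torus.aestronglyMeasurable_diff_mul_diff hf.1 hg.1
    exact ((hk.aestronglyMeasurable.comp_snd (μ := volume)).mul this).integral_prod_right'
  have hpt : ∀ x, ((fun y => f y * g y) ⋆ FunctionSpaces.Torus.kernel ε) x - (f ⋆ FunctionSpaces.Torus.kernel ε) x * (g ⋆ FunctionSpaces.Torus.kernel ε) x =
      r x - ef x * eg x := fun x => FunctionSpaces.Torus.convolution_mul_sub_mul_convolution hfi hgi hfg hε hε' x
  -- CET (6) with exponent 2
  have hε2 : ∀ {φ : UnitAddTorus d → ℝ} (_ : Integrable φ volume) {A : ℝ≥0∞},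
      (∀ y : UnitAddTorus d, ‖y‖ ≤ ε → eLpNorm (fun x => φ (x - y) - φ x) 2 volume ≤ A) →
      eLpNorm (fun x => φ x - (φ ⋆ FunctionSpaces.Torus.kernel ε) x) 2 volume ≤ A := by
    intro φ hφ A hA
    have h := FunctionSpaces.Torus.eLpNorm_convolution_kernel_sub_self_le hφ hε hε' (p := 2) one_le_two
      ENNReal.ofNat_ne_top hA
    rw [← eLpNorm_neg]
    convert h using 2
    funext x
    simp
  calc ∫⁻ x, ‖((fun y => f y * g y) ⋆ FunctionSpaces.Torus.kernel ε) x - (f ⋆ FunctionSpaces.Torus.kernel ε) x * (g ⋆ FunctionSpaces.Torus.kernel ε) x‖ₑ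
      = ∫⁻ x, ‖r x - ef x * eg x‖ₑ := by simp_rw [hpt]
    _ ≤ ∫⁻ x, ‖r x‖ₑ + ‖ef x * eg x‖ₑ := lintegral_mono fun x => enorm_sub_le
    _ = (∫⁻ x, ‖r x‖ₑ) + ∫⁻ x, ‖ef x * eg x‖ₑ := lintegral_add_left' hrm.enorm _
    _ ≤ Af * Ag + Af * Ag := by
        refine add_le_add ?_ ?_
        · have h := eLpNorm_commutatorRemainder_one_le hf.1 hg.1 hε hε' hAf hAg
          rwa [eLpNorm_one_eq_lintegral_enorm] at h
        · exact (lintegral_enorm_mul_le_two_two hefm hegm).trans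
            (mul_le_mul' (hε2 hfi hAf) (hε2 hgi hAg))
    _ = 2 * Af * Ag := by ring

/-- **The mass of a product is preserved by coarse-graining**: `∫ (θ ⋆ k_ε) = ∫ θ` for
`θ ∈ L¹(T^d)` (Mathlib's `MeasureTheory.integral_convolution` and `∫ k_ε = 1`; Drivas–Eyink
2019, §2: "for integrable `g` one has `∫ ḡ_ℓ dx = ∫ g dx`"). [cite: DrivasEyink2019, §2, proof of Lemma 2] -/
theorem integral_convolution_kernel {θ : UnitAddTorus d → ℝ} (hθ : Integrable θ volume)
    (hε : 0 < ε) (hε' : ε ≤ 1 / 4) : ∫ x, (θ ⋆ FunctionSpaces.Torus.kernel ε) x = ∫ x, θ x := by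
  rw [integral_convolution (lsmul ℝ ℝ) hθ (FunctionSpaces.Torus.continuous_kernel hε hε').integrable_unitAddTorus,
    lsmul_apply, FunctionSpaces.Torus.integral_kernel hε hε', smul_eq_mul, mul_one]

/-- **Integrated scalar cumulant bound**: for `f, g ∈ L²(T^d)` with `L²` translation moduli
`Af, Ag < ∞` at scale `ε`,
`|∫ f g - ∫ (f ⋆ k_ε)(g ⋆ k_ε)| ≤ 2 Af Ag`, since `∫ f g = ∫ (fg) ⋆ k_ε`
(Drivas–Eyink 2019, §2, proof of Lemma 1, the bound on `‖τ_ℓ(u; f)‖₁`). [cite: DrivasEyink2019, §2, proof of Lemma 1, (Otherest2)] -/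
theorem abs_integral_mul_sub_integral_convolution_mul_le {f g : UnitAddTorus d → ℝ}
    (hf : MemLp f 2 volume) (hg : MemLp g 2 volume) (hε : 0 < ε) (hε' : ε ≤ 1 / 4)
    {Af Ag : ℝ≥0∞} (hAft : Af ≠ ⊤) (hAgt : Ag ≠ ⊤)
    (hAf : ∀ y : UnitAddTorus d, ‖y‖ ≤ ε → eLpNorm (fun x => f (x - y) - f x) 2 volume ≤ Af)
    (hAg : ∀ y : UnitAddTorus d, ‖y‖ ≤ ε → eLpNorm (fun x => g (x - y) - g x) 2 volume ≤ Ag) :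
    |(∫ x, f x * g x) - ∫ x, (f ⋆ FunctionSpaces.Torus.kernel ε) x * (g ⋆ FunctionSpaces.Torus.kernel ε) x| ≤ 2 * Af.toReal * Ag.toReal := by
  have hfi : Integrable f volume := hf.integrable one_le_two
  have hgi : Integrable g volume := hg.integrable one_le_two
  have hfg : Integrable (fun x => f x * g x) volume := hf.integrable_mul hg
  have hk := FunctionSpaces.Torus.continuous_kernel (d := d) hε hε'
  have hcf : Continuous (f ⋆ FunctionSpaces.Torus.kernel ε) := FunctionSpaces.Torus.continuous_convolution hfi hk
  have hcg : Continuous (g ⋆ FunctionSpaces.Torus.kernel ε) := FunctionSpaces.Torus.continuous_convolution hgi hk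
  have h1 : Integrable ((fun y => f y * g y) ⋆ FunctionSpaces.Torus.kernel ε) volume :=
    (FunctionSpaces.Torus.continuous_convolution hfg hk).integrable_unitAddTorus
  have h2 : Integrable (fun x => (f ⋆ FunctionSpaces.Torus.kernel ε) x * (g ⋆ FunctionSpaces.Torus.kernel ε) x) volume :=
    (hcf.mul hcg).integrable_unitAddTorus
  have heq : (∫ x, f x * g x) - ∫ x, (f ⋆ FunctionSpaces.Torus.kernel ε) x * (g ⋆ FunctionSpaces.Torus.kernel ε) x =
      ∫ x, (((fun y => f y * g y) ⋆ FunctionSpaces.Torus.kernel ε) x - (f ⋆ FunctionSpaces.Torus.kernel ε) x * (g ⋆ FunctionSpaces.Torus.kernel ε) x) := by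
    rw [integral_sub h1 h2, integral_convolution_kernel hfg hε hε']
  have hfin : 2 * Af * Ag ≠ ⊤ := ENNReal.mul_ne_top (ENNReal.mul_ne_top (by norm_num) hAft) hAgt
  rw [heq]
  calc |∫ x, (((fun y => f y * g y) ⋆ FunctionSpaces.Torus.kernel ε) x - (f ⋆ FunctionSpaces.Torus.kernel ε) x * (g ⋆ FunctionSpaces.Torus.kernel ε) x)|
      ≤ (∫⁻ x, ‖((fun y => f y * g y) ⋆ FunctionSpaces.Torus.kernel ε) x -
          (f ⋆ FunctionSpaces.Torus.kernel ε) x * (g ⋆ FunctionSpaces.Torus.kernel ε) x‖ₑ).toReal := by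
        have h := norm_integral_le_lintegral_norm (μ := volume)
          (fun x => ((fun y => f y * g y) ⋆ FunctionSpaces.Torus.kernel ε) x - (f ⋆ FunctionSpaces.Torus.kernel ε) x * (g ⋆ FunctionSpaces.Torus.kernel ε) x)
        simp_rw [ofReal_norm] at h
        simpa only [Real.norm_eq_abs] using h
    _ ≤ (2 * Af * Ag).toReal :=
        ENNReal.toReal_mono hfin (lintegral_enorm_commutator_le hf hg hε hε' hAf hAg)
    _ = 2 * Af.toReal * Ag.toReal := by
        rw [ENNReal.toReal_mul, ENNReal.toReal_mul, ENNReal.toReal_ofNat]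

/-- The real inner product on `ℝ^d` in coordinates: `⟪a, b⟫ = ∑ᵢ aᵢ bᵢ`. [folklore] -/
theorem inner_eq_sum_mul (a b : EuclideanSpace ℝ d) : ⟪a, b⟫ = ∑ i, a i * b i := by
  rw [PiLp.inner_apply]
  refine Finset.sum_congr rfl fun i _ => ?_
  simp [mul_comm]

/-- **Integrated vector cumulant bound**: for `u, w ∈ L²(T^d; ℝ^d)` with `L²` translation
moduli `Au, Aw < ∞` at scale `ε`,
`|∫ ⟪u, w⟫ - ∫ ⟪u ⋆ k_ε, w ⋆ k_ε⟫| ≤ d · 2 Au Aw` (coordinatewise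
`Torus.abs_integral_mul_sub_integral_convolution_mul_le`; Drivas–Eyink 2019, §2, proof of
Lemma 1, `‖τ_ℓ(u; f)‖₁ ≤ C ℓ^{2σ} ‖u‖_{B^σ_{2,∞}} ‖f‖_{B^σ_{2,∞}}` before the Besov
specialisation). [cite: DrivasEyink2019, §2, proof of Lemma 1, (Otherest2)] -/
theorem abs_integral_inner_sub_integral_inner_vecConv_le {u w : UnitAddTorus d → EuclideanSpace ℝ d}
    (hu : MemLp u 2 volume) (hw : MemLp w 2 volume) (hε : 0 < ε) (hε' : ε ≤ 1 / 4)
    {Au Aw : ℝ≥0∞} (hAut : Au ≠ ⊤) (hAwt : Aw ≠ ⊤)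
    (hAu : ∀ y : UnitAddTorus d, ‖y‖ ≤ ε → eLpNorm (fun x => u (x - y) - u x) 2 volume ≤ Au)
    (hAw : ∀ y : UnitAddTorus d, ‖y‖ ≤ ε → eLpNorm (fun x => w (x - y) - w x) 2 volume ≤ Aw) :
    |(∫ x, ⟪u x, w x⟫) - ∫ x, ⟪vecConv u (FunctionSpaces.Torus.kernel ε) x, vecConv w (FunctionSpaces.Torus.kernel ε) x⟫| ≤
      Fintype.card d * (2 * Au.toReal * Aw.toReal) := by
  have hui : Integrable u volume := hu.integrable one_le_two
  have hwi : Integrable w volume := hw.integrable one_le_two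
  have hu2 : ∀ i, MemLp (fun y => u y i) 2 volume := fun i => hu.eval_piLp i
  have hw2 : ∀ i, MemLp (fun y => w y i) 2 volume := fun i => hw.eval_piLp i
  have hk := FunctionSpaces.Torus.continuous_kernel (d := d) hε hε'
  have hAui : ∀ (i : d) (y : UnitAddTorus d), ‖y‖ ≤ ε →
      eLpNorm (fun x => u (x - y) i - u x i) 2 volume ≤ Au := fun i y hy =>
    (FunctionSpaces.Torus.eLpNorm_apply_comp_sub_sub_le i y 2).trans (hAu y hy)
  have hAwi : ∀ (i : d) (y : UnitAddTorus d), ‖y‖ ≤ ε →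
      eLpNorm (fun x => w (x - y) i - w x i) 2 volume ≤ Aw := fun i y hy =>
    (FunctionSpaces.Torus.eLpNorm_apply_comp_sub_sub_le i y 2).trans (hAw y hy)
  -- coordinatewise splitting of both pairings
  have hI1 : ∀ i, Integrable (fun x => u x i * w x i) volume := fun i =>
    (hu2 i).integrable_mul (hw2 i)
  have hI2 : ∀ i, Integrable (fun x => ((fun y => u y i) ⋆ FunctionSpaces.Torus.kernel ε) x *
      ((fun y => w y i) ⋆ FunctionSpaces.Torus.kernel ε) x) volume := fun i =>
    ((FunctionSpaces.Torus.continuous_convolution ((hu2 i).integrable one_le_two) hk).mul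
      (FunctionSpaces.Torus.continuous_convolution ((hw2 i).integrable one_le_two) hk)).integrable_unitAddTorus
  have e1 : (∫ x, ⟪u x, w x⟫) = ∑ i, ∫ x, u x i * w x i := by
    rw [← integral_finsetSum _ fun i _ => hI1 i]
    exact integral_congr_ae (Eventually.of_forall fun x => inner_eq_sum_mul _ _)
  have e2 : (∫ x, ⟪vecConv u (FunctionSpaces.Torus.kernel ε) x, vecConv w (FunctionSpaces.Torus.kernel ε) x⟫) =
      ∑ i, ∫ x, ((fun y => u y i) ⋆ FunctionSpaces.Torus.kernel ε) x * ((fun y => w y i) ⋆ FunctionSpaces.Torus.kernel ε) x := by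
    rw [← integral_finsetSum _ fun i _ => hI2 i]
    refine integral_congr_ae (Eventually.of_forall fun x => ?_)
    dsimp only
    rw [inner_eq_sum_mul]
    rfl
  rw [e1, e2, ← Finset.sum_sub_distrib]
  calc |∑ i, ((∫ x, u x i * w x i) -
        ∫ x, ((fun y => u y i) ⋆ FunctionSpaces.Torus.kernel ε) x * ((fun y => w y i) ⋆ FunctionSpaces.Torus.kernel ε) x)|
      ≤ ∑ i, |(∫ x, u x i * w x i) -
          ∫ x, ((fun y => u y i) ⋆ FunctionSpaces.Torus.kernel ε) x * ((fun y => w y i) ⋆ FunctionSpaces.Torus.kernel ε) x| :=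
        Finset.abs_sum_le_sum_abs _ _
    _ ≤ ∑ _i : d, 2 * Au.toReal * Aw.toReal := Finset.sum_le_sum fun i _ =>
        abs_integral_mul_sub_integral_convolution_mul_le (hu2 i) (hw2 i) hε hε' hAut hAwt
          (hAui i) (hAwi i)
    _ = Fintype.card d * (2 * Au.toReal * Aw.toReal) := by
        simp only [Finset.sum_const, Finset.card_univ, nsmul_eq_mul]

/-- **The data cumulant bound**: for `v ∈ L²(T^d; ℝ^d)` with `L²` translation modulus
`Av < ∞` at scale `ε`, `|E(v) - E(v ⋆ k_ε)| ≤ d Av²` (Drivas–Eyink 2019, §2, proof of Lemma 1,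
`½ ‖τ_ℓ(u₀; u₀)‖₁ = ½ ∫ (|u₀|² - |(u₀)_ℓ|²)` and its bound (Otherest1), before the Besov
specialisation). [cite: DrivasEyink2019, §2, proof of Lemma 1, (Otherest1)] -/
theorem abs_kineticEnergy_sub_kineticEnergy_vecConv_le {v : UnitAddTorus d → EuclideanSpace ℝ d}
    (hv : MemLp v 2 volume) (hε : 0 < ε) (hε' : ε ≤ 1 / 4) {Av : ℝ≥0∞} (hAvt : Av ≠ ⊤)
    (hAv : ∀ y : UnitAddTorus d, ‖y‖ ≤ ε → eLpNorm (fun x => v (x - y) - v x) 2 volume ≤ Av) :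
    |FunctionSpaces.Torus.kineticEnergy v - FunctionSpaces.Torus.kineticEnergy (vecConv v (FunctionSpaces.Torus.kernel ε))| ≤
      Fintype.card d * Av.toReal ^ 2 := by
  have h := abs_integral_inner_sub_integral_inner_vecConv_le hv hv hε hε' hAvt hAvt hAv hAv
  have e : FunctionSpaces.Torus.kineticEnergy v - FunctionSpaces.Torus.kineticEnergy (vecConv v (FunctionSpaces.Torus.kernel ε)) =
      2⁻¹ * ((∫ x, ⟪v x, v x⟫) - ∫ x, ⟪vecConv v (FunctionSpaces.Torus.kernel ε) x, vecConv v (FunctionSpaces.Torus.kernel ε) x⟫) := by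
    simp only [FunctionSpaces.Torus.kineticEnergy, real_inner_self_eq_norm_sq]
    ring
  rw [e, abs_mul, abs_of_pos (by norm_num : (0 : ℝ) < 2⁻¹)]
  have hd : (0 : ℝ) ≤ Fintype.card d := Nat.cast_nonneg _
  nlinarith [h, sq_nonneg Av.toReal]

/-! ### Besov specialisations (`A = [·]_{B^σ_{2,∞}} ε^σ`) -/

/-- **Data cumulant, Besov form** (Drivas–Eyink 2019, §2, proof of Lemma 1, (Otherest1):
`‖τ_ℓ(u₀; u₀)‖₁ ≤ C ℓ^{2σ} ‖u₀‖²_{B^σ_{2,∞}}`): for `v ∈ B^σ_{2,∞}(T^d; ℝ^d)`, `0 < σ`,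
`|E(v) - E(v ⋆ k_ε)| ≤ d ε^{2σ} [v]²_{B^σ_{2,∞}}`. [cite: DrivasEyink2019, §2, proof of Lemma 1, (Otherest1)] -/
theorem abs_kineticEnergy_sub_kineticEnergy_vecConv_le_of_memBesovSup
    {v : UnitAddTorus d → EuclideanSpace ℝ d} {σ : ℝ} (hσ : 0 < σ) (hv : FunctionSpaces.MemBesovSup σ 2 v volume)
    (hε : 0 < ε) (hε' : ε ≤ 1 / 4) :
    |FunctionSpaces.Torus.kineticEnergy v - FunctionSpaces.Torus.kineticEnergy (vecConv v (FunctionSpaces.Torus.kernel ε))| ≤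
      Fintype.card d * (FunctionSpaces.eBesovSupSeminorm σ 2 v volume).toReal ^ 2 * ε ^ (2 * σ) := by
  set S : ℝ≥0∞ := FunctionSpaces.eBesovSupSeminorm σ 2 v volume with hS
  have hStop : S ≠ ⊤ := hv.2.ne
  have hA : ∀ y : UnitAddTorus d, ‖y‖ ≤ ε →
      eLpNorm (fun x => v (x - y) - v x) 2 volume ≤ S * ENNReal.ofReal (ε ^ σ) := fun y hy =>
    FunctionSpaces.Torus.eLpNorm_comp_sub_sub_le_eBesovSupSeminorm hσ hy
  have h := abs_kineticEnergy_sub_kineticEnergy_vecConv_le hv.1 hε hε'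
    (ENNReal.mul_ne_top hStop ENNReal.ofReal_ne_top) hA
  have hεσ : 0 ≤ ε ^ σ := Real.rpow_nonneg hε.le σ
  rw [ENNReal.toReal_mul, ENNReal.toReal_ofReal hεσ] at h
  refine h.trans (le_of_eq ?_)
  rw [show (2 : ℝ) * σ = σ + σ by ring, Real.rpow_add hε]
  ring

/-- **Force cumulant, Besov form** (Drivas–Eyink 2019, §2, proof of Lemma 1, (Otherest2):
`‖τ_ℓ(u; f)‖₁ ≤ C ℓ^{2σ} ‖u‖_{B^σ_{2,∞}} ‖f‖_{B^σ_{2,∞}}`): for `u, w ∈ B^σ_{2,∞}(T^d; ℝ^d)`,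
`0 < σ`, `|∫ ⟪u, w⟫ - ∫ ⟪u ⋆ k_ε, w ⋆ k_ε⟫| ≤ 2 d ε^{2σ} [u]_{B^σ_{2,∞}} [w]_{B^σ_{2,∞}}`. [cite: DrivasEyink2019, §2, proof of Lemma 1, (Otherest2)] -/
theorem abs_integral_inner_sub_integral_inner_vecConv_le_of_memBesovSup
    {u w : UnitAddTorus d → EuclideanSpace ℝ d} {σ : ℝ} (hσ : 0 < σ)
    (hu : FunctionSpaces.MemBesovSup σ 2 u volume) (hw : FunctionSpaces.MemBesovSup σ 2 w volume) (hε : 0 < ε)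
    (hε' : ε ≤ 1 / 4) :
    |(∫ x, ⟪u x, w x⟫) - ∫ x, ⟪vecConv u (FunctionSpaces.Torus.kernel ε) x, vecConv w (FunctionSpaces.Torus.kernel ε) x⟫| ≤
      2 * Fintype.card d * (FunctionSpaces.eBesovSupSeminorm σ 2 u volume).toReal *
        (FunctionSpaces.eBesovSupSeminorm σ 2 w volume).toReal * ε ^ (2 * σ) := by
  set Su : ℝ≥0∞ := FunctionSpaces.eBesovSupSeminorm σ 2 u volume with hSu
  set Sw : ℝ≥0∞ := FunctionSpaces.eBesovSupSeminorm σ 2 w volume with hSw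
  have hSut : Su ≠ ⊤ := hu.2.ne
  have hSwt : Sw ≠ ⊤ := hw.2.ne
  have hAu : ∀ y : UnitAddTorus d, ‖y‖ ≤ ε →
      eLpNorm (fun x => u (x - y) - u x) 2 volume ≤ Su * ENNReal.ofReal (ε ^ σ) := fun y hy =>
    FunctionSpaces.Torus.eLpNorm_comp_sub_sub_le_eBesovSupSeminorm hσ hy
  have hAw : ∀ y : UnitAddTorus d, ‖y‖ ≤ ε →
      eLpNorm (fun x => w (x - y) - w x) 2 volume ≤ Sw * ENNReal.ofReal (ε ^ σ) := fun y hy =>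
    FunctionSpaces.Torus.eLpNorm_comp_sub_sub_le_eBesovSupSeminorm hσ hy
  have h := abs_integral_inner_sub_integral_inner_vecConv_le hu.1 hw.1 hε hε'
    (ENNReal.mul_ne_top hSut ENNReal.ofReal_ne_top) (ENNReal.mul_ne_top hSwt ENNReal.ofReal_ne_top)
    hAu hAw
  have hεσ : 0 ≤ ε ^ σ := Real.rpow_nonneg hε.le σ
  rw [ENNReal.toReal_mul, ENNReal.toReal_mul, ENNReal.toReal_ofReal hεσ] at h
  refine h.trans (le_of_eq ?_)
  rw [show (2 : ℝ) * σ = σ + σ by ring, Real.rpow_add hε]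
  ring

end Cumulant

/-! ## The resolved dissipation -/

section Dissipation

variable [DecidableEq d]

/-- Coordinates commute with partial derivatives: for a `C¹` field `V : T^d → ℝ^ι`,
`(∂ⱼ V (x))ᵢ = ∂ⱼ Vᵢ (x)` (the coordinate map is a continuous linear map). [folklore] -/
theorem partialDeriv_apply_eq {ι : Type*} [Fintype ι] {V : UnitAddTorus d → EuclideanSpace ℝ ι}
    (hV : FunctionSpaces.Torus.IsContDiff 1 V) (j : d) (x : UnitAddTorus d) (i : ι) :
    FunctionSpaces.Torus.partialDeriv j V x i = FunctionSpaces.Torus.partialDeriv j (fun y => V y i) x := by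
  have hVi : FunctionSpaces.Torus.IsContDiff 1 (fun y => V y i) :=
    (EuclideanSpace.proj i : EuclideanSpace ℝ ι →L[ℝ] ℝ).contDiff.comp hV
  have hd : HasFDerivAt (FunctionSpaces.Torus.liftAt V x) (FunctionSpaces.Torus.fderiv V x) 0 :=
    (((hV.liftAt x).differentiable one_ne_zero).differentiableAt).hasFDerivAt
  have hcomp : FunctionSpaces.Torus.fderiv (fun y => V y i) x =
      (EuclideanSpace.proj i : EuclideanSpace ℝ ι →L[ℝ] ℝ).comp (FunctionSpaces.Torus.fderiv V x) := by
    have h : FunctionSpaces.Torus.liftAt (fun y => V y i) x =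
        (EuclideanSpace.proj i : EuclideanSpace ℝ ι →L[ℝ] ℝ) ∘ FunctionSpaces.Torus.liftAt V x := by
      funext v; rfl
    rw [FunctionSpaces.Torus.fderiv, FunctionSpaces.Torus.fderiv, h]
    exact ((EuclideanSpace.proj i).hasFDerivAt.comp (0 : EuclideanSpace ℝ d) hd).fderiv
  rw [FunctionSpaces.Torus.partialDeriv_eq_fderiv_apply hV, FunctionSpaces.Torus.partialDeriv_eq_fderiv_apply hVi, hcomp]
  rfl

omit [DecidableEq d] in
/-- For a continuous real function on the torus, `∫ g² = ‖g‖²_{L²}` (real form). [folklore] -/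
theorem integral_sq_eq_toReal_eLpNorm_sq {g : UnitAddTorus d → ℝ} (hg : Continuous g) :
    ∫ x, g x ^ 2 = (eLpNorm g 2 volume).toReal ^ 2 := by
  have hgm : MemLp g 2 volume :=
    hg.memLp_of_hasCompactSupport (HasCompactSupport.of_compactSpace g)
  have h := hgm.eLpNorm_eq_integral_rpow_norm two_ne_zero ENNReal.ofNat_ne_top
  have hint : ∫ x, ‖g x‖ ^ (2 : ℝ≥0∞).toReal = ∫ x, g x ^ 2 := by
    refine integral_congr_ae (Eventually.of_forall fun x => ?_)
    simp only [ENNReal.toReal_ofNat, Real.rpow_two, Real.norm_eq_abs, sq_abs]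
  rw [hint, ENNReal.toReal_ofNat] at h
  have hI : 0 ≤ ∫ x, g x ^ 2 := integral_nonneg fun _ => sq_nonneg _
  rw [h, ENNReal.toReal_ofReal (by positivity)]
  conv_rhs => rw [← Real.rpow_two, ← Real.rpow_mul hI, inv_mul_cancel₀ two_ne_zero,
    Real.rpow_one]

omit [DecidableEq d] in
/-- `(a.toReal)² ≤ (b.toReal)²`-type monotonicity: if `a ≤ b` in `ℝ≥0∞` and `b ≠ ∞` then
`a.toReal ^ 2 ≤ b.toReal ^ 2`. [folklore] -/
theorem toReal_sq_le_toReal_sq {a b : ℝ≥0∞} (hb : b ≠ ⊤) (h : a ≤ b) :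
    a.toReal ^ 2 ≤ b.toReal ^ 2 := by
  have := ENNReal.toReal_mono hb h
  gcongr

/-- **The resolved dissipation against the `L²` translation modulus** (Drivas–Eyink 2019, §2,
proof of Lemma 1, (viscEst); Constantin–E–Titi 1994, (7)): for `v ∈ L¹(T^d; ℝ^d)` whose `L²`
translation modulus at scale `ε` is at most `A < ∞`,
`‖∇(v ⋆ k_ε)‖₂² = ∫ ∑ⱼ ‖∂ⱼ(v ⋆ k_ε)‖² ≤ d² (C₁/ε)² A²` (each of the `d²` scalar derivatives
`∂ⱼ(vᵢ ⋆ k_ε)` has `‖·‖_{L²} ≤ (C₁/ε) A`, `Torus.eLpNorm_partialDeriv_convolution_kernel_le`). [cite: DrivasEyink2019, §2, proof of Lemma 1, (viscEst)] -/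
theorem gradNormSq_vecConv_kernel_le {v : UnitAddTorus d → EuclideanSpace ℝ d}
    (hv : Integrable v volume) (hε : 0 < ε) (hε' : ε ≤ 1 / 4) {A : ℝ≥0∞} (hAt : A ≠ ⊤)
    (hA : ∀ y : UnitAddTorus d, ‖y‖ ≤ ε → eLpNorm (fun x => v (x - y) - v x) 2 volume ≤ A) :
    FunctionSpaces.Torus.gradNormSq (vecConv v (FunctionSpaces.Torus.kernel ε)) ≤
      (Fintype.card d : ℝ) ^ 2 * ((ε⁻¹ * FunctionSpaces.Torus.gradProfileMass d) * A.toReal) ^ 2 := by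
  have hvi : ∀ i, Integrable (fun y => v y i) volume := fun i => hv.eval_piLp i
  have hk := FunctionSpaces.Torus.isSmooth_kernel (d := d) hε hε'
  have hAi : ∀ (i : d) (y : UnitAddTorus d), ‖y‖ ≤ ε →
      eLpNorm (fun x => v (x - y) i - v x i) 2 volume ≤ A := fun i y hy =>
    (FunctionSpaces.Torus.eLpNorm_apply_comp_sub_sub_le i y 2).trans (hA y hy)
  set V : UnitAddTorus d → EuclideanSpace ℝ d := vecConv v (FunctionSpaces.Torus.kernel ε) with hV
  have hVs : FunctionSpaces.Torus.IsSmooth V := FunctionSpaces.Torus.isSmooth_vecMollify hv hε hε'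
  have hV1 : FunctionSpaces.Torus.IsContDiff 1 V := hVs.isContDiff (by simp)
  have hVi : ∀ i, (fun y => V y i) = (fun y => v y i) ⋆ FunctionSpaces.Torus.kernel ε := fun i => rfl
  set L : d → d → UnitAddTorus d → ℝ := fun j i => FunctionSpaces.Torus.partialDeriv j (fun y => V y i) with hL
  have hLc : ∀ j i, Continuous (L j i) := fun j i => ((hVs.apply i).partialDeriv j).continuous
  -- `L²` bound for each `L j i`
  have hC₁ : 0 ≤ ε⁻¹ * FunctionSpaces.Torus.gradProfileMass d :=
    mul_nonneg (inv_nonneg.2 hε.le) (FunctionSpaces.Torus.gradProfileMass_nonneg (d := d))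
  have hL2 : ∀ j i, (eLpNorm (L j i) 2 volume).toReal ^ 2 ≤
      ((ε⁻¹ * FunctionSpaces.Torus.gradProfileMass d) * A.toReal) ^ 2 := by
    intro j i
    have h : eLpNorm (L j i) 2 volume ≤ ENNReal.ofReal (ε⁻¹ * FunctionSpaces.Torus.gradProfileMass d) * A := by
      simp only [hL, hVi]
      exact FunctionSpaces.Torus.eLpNorm_partialDeriv_convolution_kernel_le (hvi i) hε hε' one_le_two
        ENNReal.ofNat_ne_top (hAi i) j
    have h' := toReal_sq_le_toReal_sq (ENNReal.mul_ne_top ENNReal.ofReal_ne_top hAt) h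
    rwa [ENNReal.toReal_mul, ENNReal.toReal_ofReal hC₁] at h'
  -- the integrand in coordinates
  have hpt : ∀ x, ∑ j, ‖FunctionSpaces.Torus.partialDeriv j V x‖ ^ 2 = ∑ j, ∑ i, L j i x ^ 2 := by
    intro x
    refine Finset.sum_congr rfl fun j _ => ?_
    rw [EuclideanSpace.norm_sq_eq]
    refine Finset.sum_congr rfl fun i _ => ?_
    rw [Real.norm_eq_abs, sq_abs, partialDeriv_apply_eq hV1]
  have hint : ∀ j i, Integrable (fun x => L j i x ^ 2) volume := fun j i =>
    ((hLc j i).pow 2).integrable_unitAddTorus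
  unfold FunctionSpaces.Torus.gradNormSq
  simp_rw [hpt]
  rw [integral_finsetSum _ fun j _ => integrable_finsetSum _ fun i _ => hint j i]
  simp_rw [integral_finsetSum _ fun i _ => hint _ i]
  calc ∑ j, ∑ i, ∫ x, L j i x ^ 2
      = ∑ j, ∑ i, (eLpNorm (L j i) 2 volume).toReal ^ 2 := by
        simp_rw [integral_sq_eq_toReal_eLpNorm_sq (hLc _ _)]
    _ ≤ ∑ _j : d, ∑ _i : d, ((ε⁻¹ * FunctionSpaces.Torus.gradProfileMass d) * A.toReal) ^ 2 :=
        Finset.sum_le_sum fun j _ => Finset.sum_le_sum fun i _ => hL2 j i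
    _ = (Fintype.card d : ℝ) ^ 2 * ((ε⁻¹ * FunctionSpaces.Torus.gradProfileMass d) * A.toReal) ^ 2 := by
        simp only [Finset.sum_const, Finset.card_univ, nsmul_eq_mul]
        ring

/-- **The resolved dissipation, Besov form** (Drivas–Eyink 2019, §2, proof of Lemma 1,
(viscEst): `ν ‖∇ū_ℓ‖₂² ≤ C'_G ν ℓ^{2(σ-1)} ‖u‖²_{B^σ,∞}`, here with the `L²`-based seminorm,
which the printed `L³` one dominates on the unit torus): for `v ∈ B^σ_{2,∞}(T^d; ℝ^d)`, `0 < σ`,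
`‖∇(v ⋆ k_ε)‖₂² ≤ d² C₁² ε^{2σ-2} [v]²_{B^σ_{2,∞}}`. [cite: DrivasEyink2019, §2, proof of Lemma 1, (viscEst)] -/
theorem gradNormSq_vecConv_kernel_le_of_memBesovSup {v : UnitAddTorus d → EuclideanSpace ℝ d}
    {σ : ℝ} (hσ : 0 < σ) (hv : FunctionSpaces.MemBesovSup σ 2 v volume) (hε : 0 < ε) (hε' : ε ≤ 1 / 4) :
    FunctionSpaces.Torus.gradNormSq (vecConv v (FunctionSpaces.Torus.kernel ε)) ≤
      (Fintype.card d : ℝ) ^ 2 * FunctionSpaces.Torus.gradProfileMass d ^ 2 *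
        (FunctionSpaces.eBesovSupSeminorm σ 2 v volume).toReal ^ 2 * ε ^ (2 * σ - 2) := by
  set S : ℝ≥0∞ := FunctionSpaces.eBesovSupSeminorm σ 2 v volume with hS
  have hStop : S ≠ ⊤ := hv.2.ne
  have hA : ∀ y : UnitAddTorus d, ‖y‖ ≤ ε →
      eLpNorm (fun x => v (x - y) - v x) 2 volume ≤ S * ENNReal.ofReal (ε ^ σ) := fun y hy =>
    FunctionSpaces.Torus.eLpNorm_comp_sub_sub_le_eBesovSupSeminorm hσ hy
  have h := gradNormSq_vecConv_kernel_le (hv.1.integrable one_le_two) hε hε'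
    (ENNReal.mul_ne_top hStop ENNReal.ofReal_ne_top) hA
  have hεσ : 0 ≤ ε ^ σ := Real.rpow_nonneg hε.le σ
  rw [ENNReal.toReal_mul, ENNReal.toReal_ofReal hεσ] at h
  refine h.trans (le_of_eq ?_)
  rw [show (2 : ℝ) * σ - 2 = σ + σ + (-2) by ring, Real.rpow_add hε, Real.rpow_add hε,
    Real.rpow_neg hε.le, Real.rpow_two]
  field_simp

end Dissipation

/-! ## The flux bound -/

section Flux

variable [DecidableEq d]

/-- **The Constantin–E–Titi flux bound for `cetFlux`** (Drivas–Eyink 2019, §2, proof of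
Lemma 1, (CETflux2): `‖Π_ℓ[u(t)]‖₁ ≤ C_G ℓ^{3σ-1} ‖u(t)‖³_{B^σ_{3,∞}}`, here for the space
integral of the flux density; Constantin–E–Titi 1994, (11)–(12)): for a weakly divergence-free
`v ∈ B^σ_{3,∞}(T^d; ℝ^d)`, `0 < σ`, `0 < ε ≤ 1/4`,
`|Π_{k_ε}[v]| ≤ 2 d² C₁ [v]³_{B^σ_{3,∞}} ε^{3σ-1}` (the accepted
`Torus.abs_integral_flux_vecMollify_le_of_memBesovSup` through the bridge
`Torus.cetFlux_kernel_eq_integral_flux_vecMollify`). [cite: DrivasEyink2019, §2, proof of Lemma 1, (CETflux2)] -/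
theorem abs_cetFlux_kernel_le_of_memBesovSup {v : UnitAddTorus d → EuclideanSpace ℝ d} {σ : ℝ}
    (hσ : 0 < σ) (hB : FunctionSpaces.MemBesovSup σ 3 v volume) (hdiv : FunctionSpaces.Torus.IsWeaklyDivFree v) (hε : 0 < ε)
    (hε' : ε ≤ 1 / 4) :
    |cetFlux (FunctionSpaces.Torus.kernel ε) v| ≤ (Fintype.card d : ℝ) ^ 2 * (2 * FunctionSpaces.Torus.gradProfileMass d) *
        (FunctionSpaces.eBesovSupSeminorm σ 3 v volume).toReal ^ 3 * ε ^ (3 * σ - 1) := by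
  rw [cetFlux_kernel_eq_integral_flux_vecMollify]
  exact FunctionSpaces.Torus.abs_integral_flux_vecMollify_le_of_memBesovSup hσ hB hdiv hε hε'

end Flux

end Torus

end Literature.Analysis.FluidPDE
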